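import Literature.NumberTheory.EllipticCurves.PadicSigmaSqUniquenessProofs
import Literature.NumberTheory.EllipticCurves.X049CanonicalPAdicHeightSqTwoProofs
import HarnessLib

/-!
# The canonical `2`-adic height datum of `X₀(49)` (sigma-squared form), over `ℚ` and over `ℚ(√−7)`:
# BINDER-FREE (proofs only)

Topic `NumberTheory/EllipticCurves` (theorems only; no definition, no named fact). The instantiation
file `X049CanonicalPAdicHeightSqTwoProofs` (§2–§4) derived the existence and uniqueness of the canonical
`2`-adic height datum of `X₀(49) = 49a1` in sigma-squared form — `∃! D : PAdicHeightData cm7 2,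
D.IsCanonicalSq` over `ℚ`, `∃! DK : PAdicHeightDataK cm7 2 K, DK.IsCanonicalSq` over a quadratic `K`
with `d_K ≡ 1 (mod 8)` (e.g. `K = ℚ(√−7)`) — under the printed-fact binder
`hMT : mazurTate_sigmaSq_existsUnique_two` (Silverman 2005 §5 Rem. 2 / Mazur–Tate 1991 Thm. 3.1), whose
only use was to supply a sigma-squared pair of `49a1 ⊗ ℚ₂` (`exists_isMazurTateSigmaSqPair_two`). That
pair is now a kernel object: `(σ_CM², 0)` with `σ_CM` Perrin-Riou's CM sigma function
(`cm7_exists_isMazurTateSigmaSqPair_sq_two`, `X049CMSigmaSqTwoProofs`: Perrin-Riou 1984 Ch. III §1.2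
Lemme 2 at `v | 2`), unique (`cm7_existsUnique_isMazurTateSigmaSqPair_two`, `PadicSigmaSqUniquenessProofs`)
and equal to `(padicSigmaSq, padicSigmaSqConst)` (`cm7_padicSigmaSq_eq_sq_two'`). Feeding it to the
binder-free cores `exists(Unique)_isCanonicalSq(K)_of_exists` gives the same six statements WITHOUT `hMT`:

* `cm7_exists_isCanonicalSq_two'`, `cm7_existsUnique_isCanonicalSq_two'` (over `ℚ`);
* `cm7_exists_isCanonicalSqK_two_of_discr_mod_eight'`, `cm7_existsUnique_isCanonicalSqK_two'`,
  `cm7_existsUnique_isCanonicalSqK_two_of_discr_eq_neg_seven'` (over quadratic `K`, `d_K ≡ 1 (mod 8)` /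
  `d_K = −7`).

So on the curve of LTYZ Thm 1.1 (ii) / BCST Thm A the `p = 2` receptacle `IsCanonicalSq` is inhabited,
uniquely, by a datum whose local ingredient at `2` is Perrin-Riou's `σ_v²` — with no printed hypothesis.
(BSD is not touched; these are instantiation facts about one curve.)

## References
* [Perrin-Riou 1984] Mém. SMF 17, Ch. III §1.2, Lemme 2. [cite: Perrinriou1984, Ch. III §1.2 Lemme 2]
* [Mazur–Stein–Tate 2006] §1 («extends uniquely»), §2.7–2.8. [cite: MazurSteinTate2006, §2.7]
* [Mazur–Tate 1991] Thm. 3.1. [cite: MazurTate1991, Thm. 3.1]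
* [Marcus] *Number Fields*, Ch. 3 Thm. 25 (`2` splits in `ℚ(√m)` iff `m ≡ 1 (mod 8)`). [cite: Marcus2018, Ch. 3 Thm. 25]
-/

noncomputable section

open PowerSeries WeierstrassCurve

namespace Literature.NumberTheory.EllipticCurves

/-- **A sigma-squared pair of `X₀(49) ⊗ ℚ₂` exists — binder-free** (it is `(σ_CM², 0)`). Compare
`cm7_exists_isMazurTateSigmaSqPair_two (hMT)`. [Perrin-Riou 1984, Ch. III §1.2 Lemme 2]
[cite: Perrinriou1984, Ch. III §1.2 Lemme 2] -/
theorem cm7_exists_isMazurTateSigmaSqPair_two_binderFree :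
    ∃ Sq : PowerSeries ℚ_[2], ∃ c : ℚ_[2], (cm7.baseChange ℚ_[2]).IsMazurTateSigmaSqPair Sq c := by
  obtain ⟨σ, -, -, -, -, h⟩ := cm7_exists_isMazurTateSigmaSqPair_sq_two
  exact ⟨σ ^ 2, 0, h⟩

/-- **THE canonical `2`-adic height datum of `X₀(49)/ℚ` exists, sigma-squared form — no binder.**
[Mazur–Stein–Tate 2006, §2.7; Perrin-Riou 1984, Ch. III §1.2] [cite: MazurSteinTate2006, §2.7] -/
theorem cm7_exists_isCanonicalSq_two' : ∃ D : PAdicHeightData cm7 2, D.IsCanonicalSq := by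
  haveI := cm7_isGloballyMinimal
  exact exists_isCanonicalSq_of_exists cm7 2 cm7_exists_isMazurTateSigmaSqPair_two_binderFree

/-- **… and it is unique — no binder.** [Mazur–Stein–Tate 2006, §1, §2.7] [cite: MazurSteinTate2006, §2.7] -/
theorem cm7_existsUnique_isCanonicalSq_two' : ∃! D : PAdicHeightData cm7 2, D.IsCanonicalSq := by
  haveI := cm7_isGloballyMinimal
  exact existsUnique_isCanonicalSq_of_exists cm7 2 cm7_exists_isMazurTateSigmaSqPair_two_binderFree

/-- **THE canonical `2`-adic `K`-datum of `X₀(49)` over a quadratic `K` with `d_K ≡ 1 (mod 8)` exists,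
sigma-squared form — no binder** (`2` splits in `K`: `card_ringHom_padic_two_of_discr_mod_eight`).
[Mazur–Stein–Tate 2006, §2.8; Marcus Ch. 3 Thm. 25] [cite: MazurSteinTate2006, §2.8]
[cite: Marcus2018, Ch. 3 Thm. 25] -/
theorem cm7_exists_isCanonicalSqK_two_of_discr_mod_eight' (K : Type) [Field K] [NumberField K]
    (h2 : Module.finrank ℚ K = 2) (h8 : NumberField.discr K % 8 = 1) :
    ∃ DK : PAdicHeightDataK cm7 2 K, DK.IsCanonicalSq := by
  haveI := cm7_isGloballyMinimal
  exact exists_isCanonicalSqK_of_exists cm7 K 2 cm7_exists_isMazurTateSigmaSqPair_two_binderFree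
    (card_ringHom_padic_two_of_discr_mod_eight K h2 h8)

/-- **… exists AND is unique — no binder at all** (`49a1 ⊗ K` globally minimal for quadratic `K`,
`cm7_baseChange_isGloballyMinimal`). Compare `cm7_existsUnique_isCanonicalSqK_two (hMT)`.
[Mazur–Stein–Tate 2006, §1, §2.8] [cite: MazurSteinTate2006, §2.8] [cite: Marcus2018, Ch. 3 Thm. 25] -/
theorem cm7_existsUnique_isCanonicalSqK_two' (K : Type) [Field K] [NumberField K]
    (h2 : Module.finrank ℚ K = 2) (h8 : NumberField.discr K % 8 = 1) :
    ∃! DK : PAdicHeightDataK cm7 2 K, DK.IsCanonicalSq := by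
  haveI := cm7_isGloballyMinimal
  haveI := cm7_baseChange_isGloballyMinimal K (by omega)
  exact existsUnique_isCanonicalSqK_of_exists cm7 K 2 cm7_exists_isMazurTateSigmaSqPair_two_binderFree
    (card_ringHom_padic_two_of_discr_mod_eight K h2 h8)

/-- **Over `K` with `d_K = −7`** (the CM field `ℚ(√−7)` of `X₀(49)`, the field of LTYZ §§3–9): the
`2`-adic `K`-datum of `X₀(49)`, sigma-squared form, exists and is unique — NO hypothesis beyond
`[K : ℚ] = 2`, `d_K = −7`. [Mazur–Stein–Tate 2006, §2.8] [cite: MazurSteinTate2006, §2.8] -/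
theorem cm7_existsUnique_isCanonicalSqK_two_of_discr_eq_neg_seven' (K : Type) [Field K] [NumberField K]
    (h2 : Module.finrank ℚ K = 2) (h7 : NumberField.discr K = -7) :
    ∃! DK : PAdicHeightDataK cm7 2 K, DK.IsCanonicalSq :=
  cm7_existsUnique_isCanonicalSqK_two' K h2 (by rw [h7]; decide)

end Literature.NumberTheory.EllipticCurves
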